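import Literature.NumberTheory.QuadraticFields.InfrastructureLattice
import Literature.NumberTheory.QuadraticFields.ReducedQuadraticIrrationals
import HarnessLib

/-!
# Minima of a real quadratic order and the reduced ideals of its principal cycle

Topic `NumberTheory/QuadraticFields` (the infrastructure of a real quadratic order, III). For a
non-square `Δ ≡ 0, 1 (mod 4)` let `𝒪 = ℤ + ℤω`, `ω = (σ + √Δ)/2`, `σ = Δ mod 2`, embedded in `ℝ`; an
element is recorded by its coordinates `(x, y) ∈ ℤ²` (`ev t (x, y) = x + y(σ + t)/2` at `t = ±√Δ`,
the two real embeddings). Following Jacobson–Williams (§5.1, §5.3) a nonzero `θ ∈ 𝒪` is a *minimum*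
(`IsMin`) when no nonzero element of `𝒪` is smaller than `θ` under both embeddings — `θ` is a minimum
iff the principal fractional ideal `θ⁻¹𝒪 ∋ 1` is reduced (op. cit. §5.1, definition of a reduced ideal).

A *frame* `St = (a, b, p, r)` records a primitive ideal `𝔞 = [a, (b + √Δ)/2]` (`4a ∣ Δ - b²`)
together with the coordinates `p, r` of `θ` and `θψ`, `ψ = (b + √Δ)/2a`, where `θ⁻¹𝒪 = (1/a)𝔞`,
i.e. `𝒪 = θℤ + θψℤ` (op. cit. (5.10)–(5.11): `𝔞_j = θ_j 𝔞_1`, `𝔞_1 = [Q₀θ̄_j/r, Q₀θ̄_{j+1}/r]`);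
the invariant `Inv` is: `a ≥ 1`, `4a ∣ Δ - b²`, `ev t r · 2a = ev t p · (b + t)` for `t² = Δ` (both
embeddings at once), and `p, r` span `ℤ²`. `Red` is the reducedness `|√Δ - 2a| < b < √Δ` of
`(1/a)𝔞 = ℤ + ℤψ` (op. cit. (3.36), Thm. 5.8). Main results:

* `Inv.isMin_p`, `Inv.isMin_r`, `Inv.next_le`, `Inv.two_mul_lt` — for a reduced frame, `θ` and `θψ`
  are ADJACENT minima of `𝒪` (every minimum beyond `θ` is at least `θψ` in absolute value) and every
  minimum beyond `θψ` exceeds `2|θ|` (op. cit. Thm. 5.18 and its proof);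
* `bstep` — the reduction step `ρ` on frames (op. cit. (5.3)–(5.5): `a' = (Δ - b²)/4a`,
  `b' ≡ -b (mod 2a')` normalised below `√Δ`, new coordinates `(r, p + k r)`), with
  `Inv.bstep`, `Red.bstep` (a reduced frame steps to a reduced frame, op. cit. §5.3 first paragraph)
  and `ev_bstep_p : θ' = θψ`.

Everything is proved; no named facts. Units, the squaring step and the reduction of a non-reduced
frame are in the sequels `InfrastructureUnits.lean`, `InfrastructureSquaring.lean`.

## References

* M. J. Jacobson, Jr., H. C. Williams, *Solving the Pell Equation*, CMS Books in Mathematics, Springer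
  (2009), §3.3 (3.36), §5.1 (5.2)–(5.5), Thm. 5.8, (5.10)–(5.11), §5.3 Thm. 5.18. [JacobsonWilliams2008]
-/

noncomputable section

open scoped Classical

namespace Literature.NumberTheory.QuadraticFields.Infra

/-! ### The order `𝒪_Δ` in coordinates -/

/-- `σ = Δ mod 2 ∈ {0, 1}`, so that `ω = (σ + √Δ)/2` generates `𝒪_Δ = ℤ[ω]`. [cite: JacobsonWilliams2008, §4.1 (ω)] -/
def sig (Δ : ℕ) : ℤ := ((Δ % 2 : ℕ) : ℤ)

/-- The constant term `c_ω = (Δ - σ)/4` of `ω² = σω + c_ω`. [cite: JacobsonWilliams2008, §4.1 (ω)] -/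
def cw (Δ : ℕ) : ℤ := ((Δ : ℤ) - sig Δ) / 4

/-- `√Δ`. [folklore] -/
def rt (Δ : ℕ) : ℝ := Real.sqrt Δ

/-- The embedding with `√Δ ↦ t`: `ev t (x, y) = x + y (σ + t)/2` (`t = √Δ`: the element itself;
`t = -√Δ`: its conjugate). [cite: JacobsonWilliams2008, §4.1 (conjugation)] -/
def ev (Δ : ℕ) (t : ℝ) (p : ℤ × ℤ) : ℝ := p.1 + p.2 * ((sig Δ + t) / 2)

/-- Multiplication of `𝒪_Δ` in coordinates (`ω² = σω + c_ω`). [cite: JacobsonWilliams2008, §4.1] -/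
def omul (Δ : ℕ) (p q : ℤ × ℤ) : ℤ × ℤ :=
  (p.1 * q.1 + cw Δ * p.2 * q.2, p.1 * q.2 + p.2 * q.1 + sig Δ * p.2 * q.2)

/-- The integer combination `x p + y r` of two coordinate vectors. [folklore] -/
def lin (x y : ℤ) (p r : ℤ × ℤ) : ℤ × ℤ := (x * p.1 + y * r.1, x * p.2 + y * r.2)

/-- Admissible discriminant data: `Δ ≡ 0, 1 (mod 4)` and `Δ` not a square. [cite: JacobsonWilliams2008, §4.1] -/
structure IsDisc (Δ : ℕ) : Prop where
  four : Δ % 4 = 0 ∨ Δ % 4 = 1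
  nsq : ¬ IsSquare Δ

variable {Δ : ℕ}

/-- `σ ∈ {0, 1}`. [folklore] -/
theorem sig_eq_zero_or_one (Δ : ℕ) : sig Δ = 0 ∨ sig Δ = 1 := by
  unfold sig; omega

/-- `σ² = σ`. [folklore] -/
theorem sig_sq (Δ : ℕ) : sig Δ * sig Δ = sig Δ := by
  rcases sig_eq_zero_or_one Δ with h | h <;> simp [h]

/-- `4 c_ω = Δ - σ`. [cite: JacobsonWilliams2008, §4.1] -/
theorem four_mul_cw (hΔ : IsDisc Δ) : 4 * cw Δ = (Δ : ℤ) - sig Δ := by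
  unfold cw sig
  rcases hΔ.four with h | h <;> omega

/-- `(√Δ)² = Δ`. [folklore] -/
theorem rt_sq (Δ : ℕ) : rt Δ ^ 2 = Δ := Real.sq_sqrt (Nat.cast_nonneg _)

/-- `(-√Δ)² = Δ`. [folklore] -/
theorem neg_rt_sq (Δ : ℕ) : (-rt Δ) ^ 2 = Δ := by rw [neg_sq, rt_sq]

/-- `√Δ > 0` for a non-square. [folklore] -/
theorem rt_pos (hΔ : IsDisc Δ) : 0 < rt Δ := QuadIrr.sqrt_pos hΔ.nsq

/-- `√Δ` is irrational. [folklore] -/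
theorem irrational_rt (hΔ : IsDisc Δ) : Irrational (rt Δ) := QuadIrr.irrational_sqrt hΔ.nsq

/-- `⌊√Δ⌋ < √Δ < ⌊√Δ⌋ + 1` with `⌊√Δ⌋ = Nat.sqrt Δ`, strict below because `Δ` is not a square. [folklore] -/
theorem nat_sqrt_lt_rt (hΔ : IsDisc Δ) : (Nat.sqrt Δ : ℝ) < rt Δ ∧ rt Δ < Nat.sqrt Δ + 1 := by
  refine ⟨?_, Real.real_sqrt_lt_nat_sqrt_succ⟩
  rcases (Real.nat_sqrt_le_real_sqrt (a := Δ)).lt_or_eq with h | h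
  · exact h
  · exact absurd h ((irrational_rt hΔ).ne_nat _).symm

/-! ### Evaluation: linearity, multiplicativity, injectivity -/

/-- `ev` is `ℤ`-linear. [folklore] -/
theorem ev_lin (Δ : ℕ) (t : ℝ) (x y : ℤ) (p r : ℤ × ℤ) :
    ev Δ t (lin x y p r) = x * ev Δ t p + y * ev Δ t r := by
  unfold ev lin; push_cast; ring

/-- `ev` is multiplicative at `t = ±√Δ` (`ω_t² = σ ω_t + c_ω`). [cite: JacobsonWilliams2008, §4.1] -/
theorem ev_omul (hΔ : IsDisc Δ) {t : ℝ} (ht : t ^ 2 = Δ) (p q : ℤ × ℤ) :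
    ev Δ t (omul Δ p q) = ev Δ t p * ev Δ t q := by
  have h4 : (4 : ℝ) * cw Δ = Δ - sig Δ := by exact_mod_cast four_mul_cw hΔ
  have hs : (sig Δ : ℝ) * sig Δ = sig Δ := by exact_mod_cast sig_sq Δ
  unfold ev omul; push_cast
  linear_combination ((p.2 : ℝ) * q.2 / 4) * h4 + ((p.2 : ℝ) * q.2 / 4) * hs - ((p.2 : ℝ) * q.2 / 4) * ht

/-- `ev t p = 0` forces `p = 0` when `t` is irrational. [folklore] -/
theorem eq_zero_of_ev_eq_zero {t : ℝ} (ht : Irrational t) {p : ℤ × ℤ} (h : ev Δ t p = 0) : p = (0, 0) := by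
  unfold ev at h
  obtain ⟨x, y⟩ := p
  simp only at h
  by_cases hy : y = 0
  · subst hy
    simp only [Int.cast_zero, zero_mul, add_zero, Int.cast_eq_zero] at h
    simp [h]
  · exfalso
    have hy' : (y : ℝ) ≠ 0 := by exact_mod_cast hy
    have h2 : (y : ℝ) * t = -(2 * x + y * sig Δ) := by linear_combination 2 * h
    have : t = ((-(2 * x + y * sig Δ) : ℤ) : ℝ) / ((y : ℤ) : ℝ) := by
      rw [eq_div_iff hy']; push_cast; linear_combination h2
    exact (irrational_iff_ne_rational t).mp ht _ _ hy this

/-- `ev` is injective at an irrational `t`. [folklore] -/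
theorem ev_injective {t : ℝ} (ht : Irrational t) {p q : ℤ × ℤ} (h : ev Δ t p = ev Δ t q) : p = q := by
  have h0 : ev Δ t (lin 1 (-1) p q) = 0 := by rw [ev_lin]; push_cast; linarith
  have := eq_zero_of_ev_eq_zero ht h0
  obtain ⟨p1, p2⟩ := p
  obtain ⟨q1, q2⟩ := q
  simp only [lin, Prod.mk.injEq] at this
  obtain ⟨h1, h2⟩ := this
  refine Prod.ext ?_ ?_
  · show p1 = q1; omega
  · show p2 = q2; omega

/-- `-√Δ` is irrational. [folklore] -/
theorem irrational_neg_rt (hΔ : IsDisc Δ) : Irrational (-rt Δ) := (irrational_rt hΔ).neg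

/-! ### Minima and frames -/

/-- **Minimum of `𝒪_Δ`** (Jacobson–Williams §5.1): `θ ≠ 0` and no nonzero `β ∈ 𝒪` has `|β| < |θ|` and
`|β̄| < |θ̄|`. [cite: JacobsonWilliams2008, §5.1 (reduced ideal; minima)] -/
def IsMin (Δ : ℕ) (p : ℤ × ℤ) : Prop :=
  ev Δ (rt Δ) p ≠ 0 ∧ ∀ q : ℤ × ℤ, ev Δ (rt Δ) q ≠ 0 → |ev Δ (rt Δ) q| < |ev Δ (rt Δ) p| →
    |ev Δ (-rt Δ) p| ≤ |ev Δ (-rt Δ) q|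

/-- `p, r` span `ℤ²`. [folklore] -/
def Spans (p r : ℤ × ℤ) : Prop := ∀ q : ℤ × ℤ, ∃ x y : ℤ, q = lin x y p r

/-- Two vectors spanning `ℤ²` are linearly independent: `x p + y r = 0` forces `x = y = 0`
(the change-of-basis matrix has determinant `±1`). [folklore] -/
theorem Spans.lin_eq_zero {p r : ℤ × ℤ} (h : Spans p r) {x y : ℤ} (h0 : lin x y p r = (0, 0)) :
    x = 0 ∧ y = 0 := by
  obtain ⟨X, Y, hX⟩ := h (1, 0)
  obtain ⟨X', Y', hX'⟩ := h (0, 1)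
  simp only [lin, Prod.mk.injEq] at hX hX' h0
  obtain ⟨h1, h2⟩ := hX
  obtain ⟨h3, h4⟩ := hX'
  obtain ⟨h5, h6⟩ := h0
  have hdet : (X * Y' - Y * X') * (p.1 * r.2 - p.2 * r.1) = 1 := by
    linear_combination (-(X' * p.2 + Y' * r.2)) * h1 - h4 + (X * p.2 + Y * r.2) * h3
  have hne : p.1 * r.2 - p.2 * r.1 ≠ 0 := right_ne_zero_of_mul_eq_one hdet
  have hx : x * (p.1 * r.2 - p.2 * r.1) = 0 := by linear_combination r.2 * h5 - r.1 * h6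
  have hy : y * (p.1 * r.2 - p.2 * r.1) = 0 := by linear_combination p.1 * h6 - p.2 * h5
  exact ⟨(mul_eq_zero.mp hx).resolve_right hne, (mul_eq_zero.mp hy).resolve_right hne⟩

/-- A frame: the primitive ideal `[a, (b + √Δ)/2]` and the coordinates `p, r` of `θ, θψ` with
`𝒪 = θℤ + θψℤ`, `ψ = (b + √Δ)/2a` (Jacobson–Williams (5.7), (5.10), (5.11)). [cite: JacobsonWilliams2008, §5.1 (5.7)–(5.11)] -/
structure St where
  /-- the norm `a = N(𝔞)` -/
  a : ℕ
  /-- the numerator `b` of `ψ = (b + √Δ)/2a` -/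
  b : ℤ
  /-- coordinates of `θ` -/
  p : ℤ × ℤ
  /-- coordinates of `θψ` -/
  r : ℤ × ℤ

/-- `ψ_t = (b + t)/2a`. [cite: JacobsonWilliams2008, §5.1 (5.7)] -/
def St.psi (S : St) (t : ℝ) : ℝ := (S.b + t) / (2 * S.a)

/-- **Frame invariant**: `a ≥ 1`, `4a ∣ Δ - b²`, `θψ_t` has coordinates `r` under both embeddings, and
`θ, θψ` span `𝒪` (Jacobson–Williams (5.11)). [cite: JacobsonWilliams2008, §5.1 (5.11)] -/
def Inv (Δ : ℕ) (S : St) : Prop :=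
  1 ≤ S.a ∧ (4 * (S.a : ℤ) ∣ (Δ : ℤ) - S.b ^ 2) ∧
    (∀ t : ℝ, t ^ 2 = Δ → ev Δ t S.r * (2 * S.a) = ev Δ t S.p * (S.b + t)) ∧ Spans S.p S.r

/-- **Reducedness** of `ℤ + ℤψ`: `|√Δ - 2a| < b < √Δ`, i.e. `ψ > 1`, `-1 < ψ̄ < 0`
(Jacobson–Williams (3.36), Thm. 5.8). [cite: JacobsonWilliams2008, §3.3 (3.36)] -/
def Red (Δ : ℕ) (S : St) : Prop := |rt Δ - 2 * S.a| < S.b ∧ (S.b : ℝ) < rt Δ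

/-- A reduced frame has `ψ > 1` and `-1 < ψ̄ < 0`. [cite: JacobsonWilliams2008, §3.3 (3.36)] -/
theorem Red.psi_bounds {S : St} (hR : Red Δ S) (ha : 1 ≤ S.a) :
    1 < S.psi (rt Δ) ∧ -1 < S.psi (-rt Δ) ∧ S.psi (-rt Δ) < 0 := by
  obtain ⟨h1, h2⟩ := hR
  have ha1 : (1 : ℝ) ≤ S.a := by exact_mod_cast ha
  have ha' : (0 : ℝ) < 2 * S.a := by linarith
  rw [abs_lt] at h1
  unfold St.psi
  refine ⟨?_, ?_, ?_⟩
  · rw [lt_div_iff₀ ha']; linarith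
  · rw [lt_div_iff₀ ha']; linarith
  · exact div_neg_of_neg_of_pos (by linarith) ha'

/-- In a reduced frame `b ≥ 1`. [cite: JacobsonWilliams2008, §3.3 (3.32)] -/
theorem Red.b_pos {S : St} (hR : Red Δ S) : 1 ≤ S.b := by
  have : (0 : ℝ) < S.b := lt_of_le_of_lt (abs_nonneg _) hR.1
  exact int_one_le_of_pos this

/-- In a reduced frame `a < √Δ` (Jacobson–Williams Cor. 5.8.1). [cite: JacobsonWilliams2008, §5.1 Cor. 5.8.1] -/
theorem Red.a_lt_rt {S : St} (hR : Red Δ S) : (S.a : ℝ) < rt Δ := by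
  obtain ⟨h1, h2⟩ := hR
  rw [abs_lt] at h1
  linarith

/-- In a reduced frame `b² < Δ`. [cite: JacobsonWilliams2008, §3.3 (3.32)] -/
theorem Red.b_sq_lt {S : St} (hR : Red Δ S) : S.b ^ 2 < (Δ : ℤ) := by
  have hb : (0 : ℝ) < S.b := lt_of_le_of_lt (abs_nonneg _) hR.1
  have h : (S.b : ℝ) ^ 2 < rt Δ ^ 2 := by nlinarith [hR.2]
  rw [rt_sq] at h
  exact_mod_cast h

namespace Inv

variable {S : St}

/-- `a ≠ 0` as a real. [folklore] -/
theorem a_pos (hI : Inv Δ S) : (0 : ℝ) < S.a := by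
  have : (1 : ℝ) ≤ S.a := by exact_mod_cast hI.1
  linarith

/-- `ev t r = ev t p · ψ_t`. [cite: JacobsonWilliams2008, §5.1 (5.11)] -/
theorem ev_r (hI : Inv Δ S) {t : ℝ} (ht : t ^ 2 = Δ) : ev Δ t S.r = ev Δ t S.p * S.psi t := by
  have h := hI.2.2.1 t ht
  have ha := hI.a_pos
  unfold St.psi
  field_simp
  linarith

/-- Every `q ∈ 𝒪` evaluates to `ev t p · (x + y ψ_t)` in the frame. [cite: JacobsonWilliams2008, §5.1 (5.11)] -/
theorem ev_of_spans (hI : Inv Δ S) {t : ℝ} (ht : t ^ 2 = Δ) {q : ℤ × ℤ} {x y : ℤ}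
    (hq : q = lin x y S.p S.r) : ev Δ t q = ev Δ t S.p * (x + y * S.psi t) := by
  rw [hq, ev_lin, hI.ev_r ht]; ring

/-- `p ≠ 0` in a frame (else `r` alone would span `ℤ²`). [folklore] -/
theorem p_ne_zero (hI : Inv Δ S) : S.p ≠ (0, 0) := by
  intro hp
  obtain ⟨x, y, h1⟩ := hI.2.2.2 (1, 0)
  obtain ⟨x', y', h2⟩ := hI.2.2.2 (0, 1)
  rw [hp] at h1 h2
  unfold lin at h1 h2
  simp only [mul_zero, zero_add, Prod.mk.injEq] at h1 h2
  obtain ⟨h1a, h1b⟩ := h1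
  obtain ⟨h2a, h2b⟩ := h2
  have hr2 : S.r.2 = 0 := by
    rcases mul_eq_zero.mp h1b.symm with h | h
    · rw [h, zero_mul] at h1a; exact absurd h1a (by norm_num)
    · exact h
  rw [hr2, mul_zero] at h2b
  exact absurd h2b (by norm_num)

/-- `θ = ev √Δ p ≠ 0`. [folklore] -/
theorem ev_p_ne_zero (hΔ : IsDisc Δ) (hI : Inv Δ S) : ev Δ (rt Δ) S.p ≠ 0 :=
  fun h => hI.p_ne_zero (eq_zero_of_ev_eq_zero (irrational_rt hΔ) h)

/-- `θ̄ = ev (-√Δ) p ≠ 0`. [folklore] -/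
theorem ev_neg_p_ne_zero (hΔ : IsDisc Δ) (hI : Inv Δ S) : ev Δ (-rt Δ) S.p ≠ 0 :=
  fun h => hI.p_ne_zero (eq_zero_of_ev_eq_zero (irrational_neg_rt hΔ) h)

/-- Coordinates of a `q` with `ev q ≠ 0` are not both zero. [folklore] -/
theorem coords_ne_zero (_hI : Inv Δ S) {q : ℤ × ℤ} {x y : ℤ} (hq : q = lin x y S.p S.r)
    (hq0 : ev Δ (rt Δ) q ≠ 0) : (x, y) ≠ (0, 0) := by
  intro hxy
  simp only [Prod.mk.injEq] at hxy
  obtain ⟨rfl, rfl⟩ := hxy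
  have : q = (0, 0) := by rw [hq]; unfold lin; simp
  rw [this] at hq0
  exact hq0 (by unfold ev; simp)

/-- **`θ` is a minimum of `𝒪`** for a reduced frame (Jacobson–Williams Thm. 5.8: `(1/a)𝔞 = ℤ + ℤψ` is
reduced, i.e. `1` is a minimum of `θ⁻¹𝒪`). [cite: JacobsonWilliams2008, §5.1 Thm. 5.8] -/
theorem isMin_p (hΔ : IsDisc Δ) (hI : Inv Δ S) (hR : Red Δ S) : IsMin Δ S.p := by
  obtain ⟨hψ1, hψ2, hψ3⟩ := hR.psi_bounds hI.1
  refine ⟨hI.ev_p_ne_zero hΔ, fun q hq0 hlt => ?_⟩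
  obtain ⟨x, y, hq⟩ := hI.2.2.2 q
  have hxy := hI.coords_ne_zero hq hq0
  have h1 := hI.ev_of_spans (rt_sq Δ) hq
  have h2 := hI.ev_of_spans (neg_rt_sq Δ) hq
  have hθ := abs_pos.mpr (hI.ev_p_ne_zero hΔ)
  have hθ' := abs_pos.mpr (hI.ev_neg_p_ne_zero hΔ)
  rw [h1, abs_mul] at hlt
  have hlt' : |(x : ℝ) + y * S.psi (rt Δ)| < 1 := by
    by_contra h; push Not at h; nlinarith
  have := one_isMin hψ1 hψ2 hψ3 hxy hlt'
  rw [h2, abs_mul]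
  nlinarith [abs_nonneg (ev Δ (-rt Δ) S.p)]

/-- **`θψ` is a minimum of `𝒪`** for a reduced frame. [cite: JacobsonWilliams2008, §5.3 (5.17)] -/
theorem isMin_r (hΔ : IsDisc Δ) (hI : Inv Δ S) (hR : Red Δ S) : IsMin Δ S.r := by
  obtain ⟨hψ1, hψ2, hψ3⟩ := hR.psi_bounds hI.1
  have hθ := abs_pos.mpr (hI.ev_p_ne_zero hΔ)
  have hθ' := abs_pos.mpr (hI.ev_neg_p_ne_zero hΔ)
  have hr : ev Δ (rt Δ) S.r ≠ 0 := by
    rw [hI.ev_r (rt_sq Δ)]; exact mul_ne_zero (hI.ev_p_ne_zero hΔ) (by linarith)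
  refine ⟨hr, fun q hq0 hlt => ?_⟩
  obtain ⟨x, y, hq⟩ := hI.2.2.2 q
  have hxy := hI.coords_ne_zero hq hq0
  have h1 := hI.ev_of_spans (rt_sq Δ) hq
  have h2 := hI.ev_of_spans (neg_rt_sq Δ) hq
  rw [h1, abs_mul, hI.ev_r (rt_sq Δ), abs_mul, abs_of_pos (by linarith : (0:ℝ) < S.psi (rt Δ))] at hlt
  have hlt' : |(x : ℝ) + y * S.psi (rt Δ)| < S.psi (rt Δ) := lt_of_mul_lt_mul_left hlt hθ.le
  have := psi_isMin hψ1 hψ2 hψ3 hxy hlt'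
  rw [h2, abs_mul, hI.ev_r (neg_rt_sq Δ), abs_mul]
  exact mul_le_mul_of_nonneg_left this (abs_nonneg _)

/-- `|θ| < |θψ|`. [cite: JacobsonWilliams2008, §5.3 (5.9)] -/
theorem abs_p_lt_abs_r (hΔ : IsDisc Δ) (hI : Inv Δ S) (hR : Red Δ S) :
    |ev Δ (rt Δ) S.p| < |ev Δ (rt Δ) S.r| := by
  obtain ⟨hψ1, _, _⟩ := hR.psi_bounds hI.1
  have hθ := abs_pos.mpr (hI.ev_p_ne_zero hΔ)
  rw [hI.ev_r (rt_sq Δ), abs_mul, abs_of_pos (by linarith : (0:ℝ) < S.psi (rt Δ))]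
  nlinarith

/-- A minimum `q` beyond `θ` has strictly smaller conjugate than `θ`. [cite: JacobsonWilliams2008, §5.3 (5.18)] -/
theorem conj_lt_of_isMin (hΔ : IsDisc Δ) (hI : Inv Δ S) {q : ℤ × ℤ} (hq : IsMin Δ q)
    (hlt : |ev Δ (rt Δ) S.p| < |ev Δ (rt Δ) q|) : |ev Δ (-rt Δ) q| < |ev Δ (-rt Δ) S.p| := by
  have hle := hq.2 S.p (hI.ev_p_ne_zero hΔ) hlt
  rcases hle.lt_or_eq with h | h
  · exact h
  · exfalso
    rcases abs_eq_abs.mp h with h' | h'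
    · have := ev_injective (irrational_neg_rt hΔ) h'
      rw [this] at hlt; exact lt_irrefl _ hlt
    · have h'' : ev Δ (-rt Δ) q = ev Δ (-rt Δ) (lin (-1) 0 S.p S.r) := by
        rw [ev_lin]; push_cast; linarith
      have := ev_injective (irrational_neg_rt hΔ) h''
      rw [this, ev_lin] at hlt
      simp at hlt

/-- **Adjacency**: every minimum of `𝒪` beyond `θ` is at least `θψ` in absolute value — the step `ρ`
skips no minimum (Jacobson–Williams Thm. 5.18). [cite: JacobsonWilliams2008, §5.3 Thm. 5.18] -/
theorem next_le (hΔ : IsDisc Δ) (hI : Inv Δ S) (hR : Red Δ S) {q : ℤ × ℤ} (hq : IsMin Δ q)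
    (hlt : |ev Δ (rt Δ) S.p| < |ev Δ (rt Δ) q|) : |ev Δ (rt Δ) S.r| ≤ |ev Δ (rt Δ) q| := by
  obtain ⟨hψ1, hψ2, hψ3⟩ := hR.psi_bounds hI.1
  have hθ := abs_pos.mpr (hI.ev_p_ne_zero hΔ)
  have hθ' := abs_pos.mpr (hI.ev_neg_p_ne_zero hΔ)
  have hc := hI.conj_lt_of_isMin hΔ hq hlt
  obtain ⟨x, y, hqe⟩ := hI.2.2.2 q
  have h1 := hI.ev_of_spans (rt_sq Δ) hqe
  have h2 := hI.ev_of_spans (neg_rt_sq Δ) hqe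
  rw [h2, abs_mul] at hc
  have hc' : |(x : ℝ) + y * S.psi (-rt Δ)| < 1 := by
    by_contra h; push Not at h; nlinarith
  rw [h1, abs_mul] at hlt
  have hv' : 1 < |(x : ℝ) + y * S.psi (rt Δ)| := by
    by_contra h; push Not at h; nlinarith
  have := psi_le_of_one_lt hψ1 hψ2 hψ3 hc' hv'
  rw [h1, abs_mul, hI.ev_r (rt_sq Δ), abs_mul, abs_of_pos (by linarith : (0:ℝ) < S.psi (rt Δ))]
  exact mul_le_mul_of_nonneg_left this (abs_nonneg _)

/-- **Two steps more than double**: every minimum of `𝒪` beyond `θψ` exceeds `2|θ|`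
(Jacobson–Williams, proof of Thm. 5.18). [cite: JacobsonWilliams2008, §5.3 Thm. 5.18 (proof)] -/
theorem two_mul_lt (hΔ : IsDisc Δ) (hI : Inv Δ S) (hR : Red Δ S) {q : ℤ × ℤ} (hq : IsMin Δ q)
    (hlt : |ev Δ (rt Δ) S.r| < |ev Δ (rt Δ) q|) : 2 * |ev Δ (rt Δ) S.p| < |ev Δ (rt Δ) q| := by
  obtain ⟨hψ1, hψ2, hψ3⟩ := hR.psi_bounds hI.1
  have hθ := abs_pos.mpr (hI.ev_p_ne_zero hΔ)
  have hθ' := abs_pos.mpr (hI.ev_neg_p_ne_zero hΔ)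
  have hr0 : ev Δ (rt Δ) S.r ≠ 0 := (hI.isMin_r hΔ hR).1
  -- the conjugate of `q` is below that of `θψ`, strictly
  have hle := hq.2 S.r hr0 hlt
  have hc : |ev Δ (-rt Δ) q| < |ev Δ (-rt Δ) S.r| := by
    rcases hle.lt_or_eq with h | h
    · exact h
    · exfalso
      rcases abs_eq_abs.mp h with h' | h'
      · have := ev_injective (irrational_neg_rt hΔ) h'
        rw [this] at hlt; exact lt_irrefl _ hlt
      · have h'' : ev Δ (-rt Δ) q = ev Δ (-rt Δ) (lin 0 (-1) S.p S.r) := by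
          rw [ev_lin]; push_cast; linarith
        have := ev_injective (irrational_neg_rt hΔ) h''
        rw [this, ev_lin] at hlt
        simp at hlt
  obtain ⟨x, y, hqe⟩ := hI.2.2.2 q
  have h1 := hI.ev_of_spans (rt_sq Δ) hqe
  have h2 := hI.ev_of_spans (neg_rt_sq Δ) hqe
  rw [h2, abs_mul, hI.ev_r (neg_rt_sq Δ), abs_mul] at hc
  have hc' : |(x : ℝ) + y * S.psi (-rt Δ)| < |S.psi (-rt Δ)| := lt_of_mul_lt_mul_left hc hθ'.le
  rw [h1, abs_mul, hI.ev_r (rt_sq Δ), abs_mul, abs_of_pos (by linarith : (0:ℝ) < S.psi (rt Δ))] at hlt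
  have hv' : S.psi (rt Δ) < |(x : ℝ) + y * S.psi (rt Δ)| := lt_of_mul_lt_mul_left hlt hθ.le
  have := two_lt_of_psi_lt hψ1 hψ2 hψ3 hc' hv'
  rw [h1, abs_mul]
  nlinarith [hθ]

end Inv

variable {S : St}

/-! ### The reduction step `ρ` on frames -/

/-- The next norm `a' = (Δ - b²)/4a`. [cite: JacobsonWilliams2008, §5.1 (5.3)] -/
def St.c (Δ : ℕ) (S : St) : ℤ := ((Δ : ℤ) - S.b ^ 2) / (4 * S.a)

/-- The next numerator: the representative of `-b (mod 2a')` in `(√Δ - 2a', √Δ)`, namely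
`⌊√Δ⌋ - ((⌊√Δ⌋ + b) mod 2a')`. [cite: JacobsonWilliams2008, §5.1 (5.3)–(5.5)] -/
def St.b' (Δ : ℕ) (S : St) : ℤ := Nat.sqrt Δ - ((Nat.sqrt Δ + S.b) % (2 * S.c Δ))

/-- The shift `k = (b' + b)/2a'`. [cite: JacobsonWilliams2008, §5.1 (5.5)] -/
def St.k (Δ : ℕ) (S : St) : ℤ := (S.b' Δ + S.b) / (2 * S.c Δ)

/-- **The reduction step `ρ`** on frames: `(a, b, θ, θψ) ↦ (a', b', θψ, θ + kθψ)`
(Jacobson–Williams (5.3)–(5.5), (5.9): `𝔞_{j+1} = ψ_j 𝔞_j`). [cite: JacobsonWilliams2008, §5.1 (5.3)–(5.5)] -/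
def bstep (Δ : ℕ) (S : St) : St := ⟨(S.c Δ).toNat, S.b' Δ, S.r, lin 1 (S.k Δ) S.p S.r⟩

/-- `θ' = θψ`: the new first coordinate vector is the old second one. [cite: JacobsonWilliams2008, §5.1 (5.9)] -/
@[simp] theorem bstep_p (S : St) : (bstep Δ S).p = S.r := rfl

/-- The new second coordinate vector. [folklore] -/
@[simp] theorem bstep_r (S : St) : (bstep Δ S).r = lin 1 (S.k Δ) S.p S.r := rfl

/-- The new numerator. [folklore] -/
@[simp] theorem bstep_b (S : St) : (bstep Δ S).b = S.b' Δ := rfl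

/-- `4a · a' = Δ - b²` exactly. [cite: JacobsonWilliams2008, §5.1 (5.3)] -/
theorem Inv.four_a_c (hI : Inv Δ S) : 4 * (S.a : ℤ) * S.c Δ = (Δ : ℤ) - S.b ^ 2 := by
  unfold St.c; exact Int.mul_ediv_cancel' hI.2.1

/-- In a reduced frame `a' ≥ 1`. [cite: JacobsonWilliams2008, §5.3 (first paragraph, (5.15))] -/
theorem Inv.c_pos (hI : Inv Δ S) (hR : Red Δ S) : 1 ≤ S.c Δ := by
  have h := hI.four_a_c
  have hb := hR.b_sq_lt
  have ha : (1 : ℤ) ≤ S.a := by exact_mod_cast hI.1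
  nlinarith

/-- The new norm is `a'` (as a natural number). [folklore] -/
theorem Inv.bstep_a (hI : Inv Δ S) (hR : Red Δ S) : ((bstep Δ S).a : ℤ) = S.c Δ := by
  show (((S.c Δ).toNat : ℕ) : ℤ) = S.c Δ
  exact Int.toNat_of_nonneg (by linarith [hI.c_pos hR])

/-- `b' + b = 2a'k` exactly (`b' ≡ -b (mod 2a')`). [cite: JacobsonWilliams2008, §5.1 (5.5)] -/
theorem Inv.b'_add_b (hI : Inv Δ S) (hR : Red Δ S) : S.b' Δ + S.b = 2 * S.c Δ * S.k Δ := by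
  have hc := hI.c_pos hR
  have h1 : S.b' Δ + S.b = 2 * S.c Δ * ((Nat.sqrt Δ + S.b) / (2 * S.c Δ)) := by
    unfold St.b'
    have := Int.mul_ediv_add_emod ((Nat.sqrt Δ : ℤ) + S.b) (2 * S.c Δ)
    linarith
  have h2 : S.k Δ = (Nat.sqrt Δ + S.b) / (2 * S.c Δ) := by
    unfold St.k
    rw [h1]
    exact Int.mul_ediv_cancel_left _ (by omega)
  rw [h2]
  exact h1

/-- `√Δ - 2a' < b' < √Δ`. [cite: JacobsonWilliams2008, §5.1 (5.5)] -/
theorem Inv.b'_bounds (hΔ : IsDisc Δ) (hI : Inv Δ S) (hR : Red Δ S) :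
    rt Δ - 2 * S.c Δ < S.b' Δ ∧ (S.b' Δ : ℝ) < rt Δ := by
  obtain ⟨hs1, hs2⟩ := nat_sqrt_lt_rt hΔ
  have hc := hI.c_pos hR
  have hm0 : 0 ≤ (Nat.sqrt Δ + S.b) % (2 * S.c Δ) := Int.emod_nonneg _ (by omega)
  have hm1 : (Nat.sqrt Δ + S.b) % (2 * S.c Δ) < 2 * S.c Δ := Int.emod_lt_of_pos _ (by omega)
  unfold St.b'
  push_cast
  have hm0' : (0 : ℝ) ≤ (((Nat.sqrt Δ + S.b) % (2 * S.c Δ) : ℤ) : ℝ) := by exact_mod_cast hm0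
  have hm1' : (((Nat.sqrt Δ + S.b) % (2 * S.c Δ) : ℤ) : ℝ) + 1 ≤ 2 * S.c Δ := by
    exact_mod_cast (show (Nat.sqrt Δ + S.b) % (2 * S.c Δ) + 1 ≤ 2 * S.c Δ by omega)
  constructor <;> linarith

/-- **`ρ` preserves the frame invariant.** [cite: JacobsonWilliams2008, §5.1 (5.3)–(5.5), (5.11)] -/
theorem Inv.bstep (hI : Inv Δ S) (hR : Red Δ S) : Inv Δ (bstep Δ S) := by
  have hc := hI.c_pos hR
  have hac := hI.four_a_c
  have hbb := hI.b'_add_b hR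
  have ha_new := hI.bstep_a hR
  refine ⟨?_, ?_, ?_, ?_⟩
  · have : (1 : ℤ) ≤ (Infra.bstep Δ S).a := by rw [ha_new]; exact hc
    exact_mod_cast this
  · -- `4a' ∣ Δ - b'²`
    rw [ha_new, bstep_b]
    have h1 : (Δ : ℤ) - S.b' Δ ^ 2 = 4 * S.c Δ * (S.a - S.k Δ * (S.b' Δ - S.k Δ * S.c Δ)) := by
      have : S.b' Δ = 2 * S.c Δ * S.k Δ - S.b := by linarith
      rw [this]; linear_combination (-1 : ℤ) * hac
    rw [h1]
    exact Dvd.intro _ rfl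
  · -- the coordinate identity for the new frame
    intro t ht
    have hold := hI.2.2.1 t ht
    have hac' : (4 : ℝ) * S.a * S.c Δ = Δ - S.b ^ 2 := by exact_mod_cast hac
    have hbb' : (S.b' Δ : ℝ) + S.b = 2 * S.c Δ * S.k Δ := by exact_mod_cast hbb
    have ha' : (((Infra.bstep Δ S).a : ℕ) : ℝ) = S.c Δ := by exact_mod_cast ha_new
    rw [bstep_r, bstep_p, bstep_b, ev_lin, ha']
    push_cast
    have hθ := hI.a_pos
    -- multiply the goal by `2a ≠ 0`
    have key : (1 * ev Δ t S.p + S.k Δ * ev Δ t S.r) * (2 * S.c Δ) * (2 * S.a)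
        = ev Δ t S.r * (S.b' Δ + t) * (2 * S.a) := by
      have e1 : ev Δ t S.r * (2 * S.a) = ev Δ t S.p * (S.b + t) := hold
      linear_combination (2 * S.c Δ * S.k Δ - S.b' Δ - t : ℝ) * e1 + ev Δ t S.p * hac'
        - ev Δ t S.p * (S.b + t) * hbb' - ev Δ t S.p * ht
    have h2a : (2 * (S.a : ℝ)) ≠ 0 := by positivity
    have := mul_right_cancel₀ h2a key
    simpa using this
  · -- spanning
    intro q
    obtain ⟨x, y, hq⟩ := hI.2.2.2 q
    refine ⟨y - x * S.k Δ, x, ?_⟩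
    rw [hq, bstep_p, bstep_r]
    unfold lin
    ext <;> simp <;> ring

/-- **`ρ` of a reduced frame is reduced** (Jacobson–Williams §5.3: "if `𝔞` is any reduced ideal then
`ρ(𝔞)` is a reduced ideal"; here: `-1 < ψ̄' < 0` by the normalisation of `b'`, and `ψ' > 1` because
`θψ` is a minimum, Thm. 5.10). [cite: JacobsonWilliams2008, §5.3 (5.17)] -/
theorem Red.bstep (hΔ : IsDisc Δ) (hI : Inv Δ S) (hR : Red Δ S) : Red Δ (bstep Δ S) := by
  have hI' := hI.bstep hR
  have hc := hI.c_pos hR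
  have ha' : (((Infra.bstep Δ S).a : ℕ) : ℝ) = S.c Δ := by exact_mod_cast hI.bstep_a hR
  obtain ⟨hb1, hb2⟩ := hI.b'_bounds hΔ hR
  have hc' : (1 : ℝ) ≤ S.c Δ := by exact_mod_cast hc
  have hs := rt_pos hΔ
  have eψ : (Infra.bstep Δ S).psi (rt Δ) = (S.b' Δ + rt Δ) / (2 * S.c Δ) := by
    unfold St.psi; rw [ha', bstep_b]
  have eψ' : (Infra.bstep Δ S).psi (-rt Δ) = (S.b' Δ - rt Δ) / (2 * S.c Δ) := by
    unfold St.psi; rw [ha', bstep_b]; ring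
  have h2c : (0 : ℝ) < 2 * S.c Δ := by linarith
  have hψ2 : -1 < (Infra.bstep Δ S).psi (-rt Δ) := by rw [eψ', lt_div_iff₀ h2c]; linarith
  have hψ3 : (Infra.bstep Δ S).psi (-rt Δ) < 0 := by
    rw [eψ']; exact div_neg_of_neg_of_pos (by linarith) h2c
  have hgap : (Infra.bstep Δ S).psi (-rt Δ) < (Infra.bstep Δ S).psi (rt Δ) := by
    rw [eψ, eψ', div_lt_div_iff_of_pos_right h2c]; linarith
  have hne : (Infra.bstep Δ S).psi (rt Δ) ≠ 1 := by
    rw [eψ]; intro h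
    rw [div_eq_one_iff_eq h2c.ne'] at h
    exact (irrational_rt hΔ).ne_int (2 * S.c Δ - S.b' Δ) (by push_cast; linarith)
  -- `1` is a minimum of the new `ℤ + ℤψ'` because `θψ` is a minimum of `𝒪`
  have hmin_r : IsMin Δ (Infra.bstep Δ S).p := hI.isMin_r hΔ hR
  have hθ := abs_pos.mpr (hI'.ev_p_ne_zero hΔ)
  have hθ' := abs_pos.mpr (hI'.ev_neg_p_ne_zero hΔ)
  have hmin : ∀ x y : ℤ, (x, y) ≠ (0, 0) → |(x : ℝ) + y * (Infra.bstep Δ S).psi (rt Δ)| < 1 →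
      1 ≤ |(x : ℝ) + y * (Infra.bstep Δ S).psi (-rt Δ)| := by
    intro x y hxy hlt
    have h1 := hI'.ev_of_spans (rt_sq Δ) (rfl : lin x y (Infra.bstep Δ S).p (Infra.bstep Δ S).r = _)
    have h2 := hI'.ev_of_spans (neg_rt_sq Δ) (rfl : lin x y (Infra.bstep Δ S).p (Infra.bstep Δ S).r = _)
    have hq0 : ev Δ (rt Δ) (lin x y (Infra.bstep Δ S).p (Infra.bstep Δ S).r) ≠ 0 := by
      intro h0
      have hz := eq_zero_of_ev_eq_zero (irrational_rt hΔ) h0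
      obtain ⟨hx, hy⟩ := Spans.lin_eq_zero hI'.2.2.2 hz
      exact hxy (by rw [hx, hy])
    have hlt' : |ev Δ (rt Δ) (lin x y (Infra.bstep Δ S).p (Infra.bstep Δ S).r)| <
        |ev Δ (rt Δ) (Infra.bstep Δ S).p| := by
      rw [h1, abs_mul]; nlinarith
    have key := hmin_r.2 _ hq0 hlt'
    rw [h2, abs_mul] at key
    by_contra hcon
    push Not at hcon
    nlinarith
  have hψ1 := one_lt_psi_of_isMin hψ2 hψ3 hgap hne hmin
  -- translate back to `|√Δ - 2a'| < b' < √Δ`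
  refine ⟨?_, by rw [bstep_b]; exact hb2⟩
  rw [eψ, lt_div_iff₀ h2c] at hψ1
  rw [ha', bstep_b, abs_lt]
  constructor <;> linarith

/-- After the step, `θ' = θψ` exactly. [cite: JacobsonWilliams2008, §5.1 (5.9)] -/
theorem Inv.ev_bstep_p (hI : Inv Δ S) {t : ℝ} (ht : t ^ 2 = Δ) :
    ev Δ t (Infra.bstep Δ S).p = ev Δ t S.p * S.psi t := by
  rw [bstep_p, hI.ev_r ht]

end Literature.NumberTheory.QuadraticFields.Infra

end
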